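import Summits.HodgeConjecture.HodgeConjecture.Theorems.SiegelUniversalFamilyHodgeFrames
import Literature.AlgebraicGeometry.ModuliOfAbelianVarieties.SiegelFineModuliFibreTriples
import Literature.AlgebraicGeometry.ModuliOfAbelianVarieties.SiegelAdelicMarkingRebaseToUnitBasis
import Literature.AlgebraicGeometry.HodgeTheory.LocallyTrivialOnChartBall
import Literature.AlgebraicGeometry.HodgeTheory.FlatIntegralFrameExists
import Literature.AlgebraicGeometry.HodgeTheory.AbelianVarietyUniformisationOfIntegralFrame
import Literature.AlgebraicGeometry.HodgeTheory.RationalTransportIntegralLattice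
import Literature.AlgebraicGeometry.HodgeTheory.ComplexTorusRebaseToIntegralFrame
import Literature.AlgebraicGeometry.HodgeTheory.RationalClassesIndependent
import Literature.AlgebraicGeometry.HodgeTheory.IntermediateJacobian
import Literature.AlgebraicGeometry.HodgeTheory.FermatHypersurfaceReduction
import Literature.AlgebraicGeometry.Motives.ComplexPointsManifold
import HarnessLib

/-!
# Flat-framed, uniformised fibres of the Siegel universal family over a chart ball

Sub-problem `HodgeConjecture` (cell HC_CM, (U)-lane node P4 «local holomorphic period map», third-layer socket
(B1a) `UHead.Ue_P4b1a_flatFrameUniformisations` of the P4 lead's sockets file v0.6).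

For the Siegel fine moduli scheme `𝓜 = 𝒜_{g,δ,N}` over `ℚ` (`3 ≤ N`, `M` and the universal total space
quasi-projective), a principal adelic representative `r ∈ K_δ(1)` and a triple `P₀` over `Spec ℂ` admissible at
`(r, Z₀)`, we produce — around the classifying point `x₀` of `P₀` in `M(ℂ)` — an open, path-connected chart ball `W`
(inside the algebraic chart at `x₀`; contractible, so simply connected), cohomologically locally trivial for the
complexified universal family `X ⊗ ℂ → M ⊗ ℂ`, together with, for every `x ∈ W`:

* a fibre triple `P′ x` over `Spec ℂ` WITH base-change witnesses `(G x, Ĝ x)` from the universal triple, classified by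
  `x` ([MumfordFogartyKirwan1994] Ch. 7 §2 Def. 7.3 / §3 Thm. 7.9 — ★ `SiegelFineModuliScheme.exists_triple_…`);
* a FLAT INTEGRAL FRAME `γ x` of `H¹(X_x(ℂ); ℚ)` ([VoisinHodgeI2002] §9.2.1: trivial monodromy on the simply connected
  `W`, ★ `exists_flatIntegralFrame_eq_of_simplyConnectedSpace`);
* an additive analytification `φ x : ℂ^g/Φx(ℤ^{2g}) → A_x(ℂ)` FRAMED BY `γ x` through the pinned identification
  `e x : A_x(ℂ) ≃ₜ X_x(ℂ)` ([Lange2023AbelianVarietiesComplex] §1.1 Lemma 1.1.17 (a), ★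
  `AbelianVariety.exists_uniformisation_of_basis_integralLattice`);
* an ample `IsLambdaOfAt` witness `Θ x` of the polarisation (★ D2 `Polarization.exists_ample`);

and, AT `x₀`, the uniformisation IS a Siegel adelic marking `m₀` by `[J(Z₀), r]` with `γ = 1` (★ (R0)
`SiegelAdelicMarking.exists_rebase_γ_eq_one`) whose torsion tower matches a symplectic lift `Λ₀` of
`((P′ x₀).level, Θ x₀)` (the clauses of ★ `IsAdmissibleAt`; [Milne2005ShimuraVarieties] Thm. 6.11 + (63)).
Main result: `ue_P4b1a_flatFrameUniformisations_holds` (socket text, `IsFlatIntegralFrame` spelled out as its clauses).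
-/

set_option autoImplicit false
set_option linter.dupNamespace false

noncomputable section

open CategoryTheory CategoryTheory.Limits AlgebraicGeometry Matrix Topology
open Literature.AlgebraicGeometry
open Literature.AlgebraicGeometry.Motives (SchemeOver ComplexPoints AlgPoints specOver AbelianVariety CartierDivisor fiberOver)
open Literature.AlgebraicGeometry.HodgeTheory (ofRatClass ofRatClass_injective)
open Literature.AlgebraicGeometry.AbelianSchemes (PolarizedAbelianSchemeWithLevel AbelianSchemeOver)
open Literature.AlgebraicGeometry.ModuliOfAbelianVarieties
open Literature.AlgebraicGeometry.ModuliOfAbelianVarieties.SiegelModuli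
open Literature.Geometry.Kaehler (ComplexTorus)
open Literature.NumberTheory.Transcendental (IsAnalytification)
open Literature.NumberTheory.Automorphic (siegelUpperHalfSpace)
open Literature.NumberTheory.Adeles
open Literature.AlgebraicTopology.SingularHomology

namespace Summit.HodgeConjecture.HodgeConjecture.Theorems

namespace UnivFamilyFlatFramedFibres

/-! ### §1 Rational frames: `ℚ`-independence versus `ℂ`-independence of the complexified classes -/

section Frames

open Literature.AlgebraicGeometry.HodgeTheory

/-- If the complexified classes `v a ⊗ 1 ∈ Hᵏ(Y; ℂ)` are `ℂ`-linearly independent, the rational classes `v a` are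
`ℚ`-linearly independent (`Hᵏ(Y; ℚ) → Hᵏ(Y; ℂ)` is additive and `ℚ`-homogeneous). [cite: VoisinHodgeI2002, §7.1.1] -/
theorem linearIndependent_rat_of_ofRatClass {Y : Type} [TopologicalSpace Y] {ι : Type} [Fintype ι] {k : ℕ}
    {v : ι → singularCohomology ℚ ℚ Y k} (hv : LinearIndependent ℂ fun a => ofRatClass Y k (v a)) :
    LinearIndependent ℚ v := by
  classical
  rw [Fintype.linearIndependent_iff] at hv ⊢
  intro q hq a
  have h0 : ∑ a, ((q a : ℚ) : ℂ) • ofRatClass Y k (v a) = 0 := by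
    have := congrArg (ofRatClass Y k) hq
    rw [map_sum, map_zero] at this
    simpa only [Motives.ofRatClass_smul] using this
  exact_mod_cast hv (fun a => (q a : ℂ)) h0 a

/-- `ℚ`-linearly independent rational classes have `ℂ`-linearly independent complexifications
(`Hᵏ(Y; ℚ) ⊗ ℂ ↪ Hᵏ(Y; ℂ)`; the tree's `linearIndependent_of_isRationalClass`). [cite: VoisinHodgeI2002, §7.1.1] -/
theorem linearIndependent_ofRatClass_of_rat {Y : Type} [TopologicalSpace Y] {ι : Type} [Fintype ι] {k : ℕ}
    {v : ι → singularCohomology ℚ ℚ Y k} (hv : LinearIndependent ℚ v) :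
    LinearIndependent ℂ fun a => ofRatClass Y k (v a) := by
  refine linearIndependent_of_isRationalClass (fun a => isRationalClass_ofRatClass _) fun q hq => ?_
  have h1 : ofRatClass Y k (∑ a, q a • v a) = 0 := by
    rw [map_sum]
    simpa only [Motives.ofRatClass_smul] using hq
  have h0 : ∑ a, q a • v a = 0 := ofRatClass_injective (Y := Y) k (by rw [h1, map_zero])
  funext a
  exact Fintype.linearIndependent_iff.1 hv q h0 a

variable {ι : Type} [Fintype ι] {E : Type} [NormedAddCommGroup E] [NormedSpace ℂ E] [FiniteDimensional ℂ E]

/-- **A `ℤ`-basis of `H¹(X(ℂ); ℤ)/tors` read through a torus uniformisation is an integral frame.**  If `ℓ` is a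
`ℤ`-basis of `integralLattice X 1` whose pull-backs along `ψ : E/Φ(ℤ^ι) → X(ℂ)` are the canonical lattice classes
`ξₐ`, then the complexified classes `ℓ a ⊗ 1` are `ℂ`-linearly independent and their `ℤ`-span is exactly the set of
integral classes of `H¹(X(ℂ); ℂ)`. [cite: Lange2023AbelianVarietiesComplex, §1.1.3 Lemma 1.1.17 (a) (p. 14)]
[cite: VoisinHodgeI2002, §7.1.1] -/
theorem frame_of_basis_integralLattice (Φ : (ι → ℝ) ≃L[ℝ] E) {X : SchemeOver ℂ}
    (ψ : C(ComplexTorus Φ, ComplexPoints X)) (ℓ : Module.Basis ι ℤ (integralLattice X 1))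
    (hℓ : ∀ a, singularCohomology.map ℚ ℚ ψ 1
      ((ℓ a : integralLattice X 1) : singularCohomology ℚ ℚ (ComplexPoints X) 1) = latticeClass Φ a) :
    (LinearIndependent ℂ fun a =>
        ofRatClass _ 1 ((ℓ a : integralLattice X 1) : singularCohomology ℚ ℚ (ComplexPoints X) 1)) ∧
      ∀ c : complexBetti X 1, IsIntegralClass c ↔
        c ∈ Submodule.span ℤ (Set.range fun a =>
          ofRatClass _ 1 ((ℓ a : integralLattice X 1) : singularCohomology ℚ ℚ (ComplexPoints X) 1)) := by
  classical
  set v : ι → singularCohomology ℚ ℚ (ComplexPoints X) 1 :=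
    fun a => ((ℓ a : integralLattice X 1) : singularCohomology ℚ ℚ (ComplexPoints X) 1)
  -- `ℚ`-independence through `ψ^*`: the images are the basis `latticeBasisHOne Φ`
  have hvQ : LinearIndependent ℚ v := by
    refine LinearIndependent.of_comp (singularCohomology.map ℚ ℚ ψ 1).hom ?_
    have hcomp : ((singularCohomology.map ℚ ℚ ψ 1).hom : _ → _) ∘ v = fun a => latticeBasisHOne Φ a := by
      funext a
      rw [Function.comp_apply, latticeBasisHOne_apply]
      exact hℓ a
    rw [hcomp]
    exact (latticeBasisHOne Φ).linearIndependent
  refine ⟨linearIndependent_ofRatClass_of_rat hvQ, fun c => ⟨fun hc => ?_, fun hc => ?_⟩⟩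
  · -- an integral class is rational, `c = y ⊗ 1` with `y ∈ integralLattice`, and `y = Σ nₐ ℓₐ`
    obtain ⟨y, rfl⟩ := (isRationalClass_iff_mem_range_ofRatClass c).1 hc.isRationalClass
    have hy : y ∈ integralLattice X 1 := mem_integralLattice_iff.2 hc
    have hrepr := ℓ.sum_repr ⟨y, hy⟩
    have hy' : y = ∑ a, (ℓ.repr ⟨y, hy⟩ a) • v a := by
      have h := congrArg (fun z : integralLattice X 1 => (z : singularCohomology ℚ ℚ (ComplexPoints X) 1)) hrepr
      simp only [Submodule.coe_sum, Submodule.coe_smul_of_tower] at h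
      exact h.symm
    rw [hy', map_sum]
    refine Submodule.sum_mem _ fun a _ => ?_
    rw [map_zsmul]
    exact Submodule.smul_mem _ _ (Submodule.subset_span ⟨a, rfl⟩)
  · -- the `ℤ`-span of integral classes is integral
    have hle : Submodule.span ℤ (Set.range fun a =>
        ofRatClass _ 1 ((ℓ a : integralLattice X 1) : singularCohomology ℚ ℚ (ComplexPoints X) 1)) ≤
        (integralClasses (ComplexPoints X) 1).toIntSubmodule :=
      Submodule.span_le.2 (by
        rintro _ ⟨a, rfl⟩
        exact mem_integralClasses.2 (mem_integralLattice_iff.1 (ℓ a).2))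
    exact mem_integralClasses.1 (hle hc : c ∈ integralClasses (ComplexPoints X) 1)

omit [NormedAddCommGroup E] [NormedSpace ℂ E] [FiniteDimensional ℂ E] in
/-- **An integral frame transported along a homeomorphism is a `ℤ`-basis of `H¹(X(ℂ); ℤ)/tors`.**  For a homeomorphism
`h : X(ℂ) ≃ₜ Y(ℂ)` and rational classes `γ a ∈ H¹(Y(ℂ); ℚ)` whose complexifications are `ℂ`-independent with `ℤ`-span
the integral classes, the pulled-back classes `h^* γ a` form a `ℤ`-basis of `integralLattice X 1` (pull-back along a
homeomorphism preserves and reflects integrality). [cite: VoisinHodgeI2002, §7.1.1] [cite: HatcherAT2002, §3.1 p. 198] -/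
theorem exists_basis_integralLattice_of_frame {X Y : SchemeOver ℂ} (h : ComplexPoints X ≃ₜ ComplexPoints Y)
    (γ : ι → singularCohomology ℚ ℚ (ComplexPoints Y) 1)
    (hli : LinearIndependent ℂ fun a => ofRatClass _ 1 (γ a))
    (hint : ∀ c : complexBetti Y 1, IsIntegralClass c ↔
      c ∈ Submodule.span ℤ (Set.range fun a => ofRatClass _ 1 (γ a))) :
    ∃ b : Module.Basis ι ℤ (integralLattice X 1),
      ∀ a, ((b a : integralLattice X 1) : singularCohomology ℚ ℚ (ComplexPoints X) 1) =
        singularCohomology.map ℚ ℚ (h : C(ComplexPoints X, ComplexPoints Y)) 1 (γ a) := by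
  classical
  -- the transported classes are integral
  have hmem : ∀ a, singularCohomology.map ℚ ℚ (h : C(ComplexPoints X, ComplexPoints Y)) 1 (γ a) ∈
      integralLattice X 1 := fun a => by
    rw [mem_integralLattice_iff, isIntegralClass_Motives.ofRatClass_map_iff_of_homeomorph h]
    exact (hint _).2 (Submodule.subset_span ⟨a, rfl⟩)
  let v : ι → integralLattice X 1 := fun a => ⟨_, hmem a⟩
  -- `ℚ`-independence of the transported classes
  have hγQ : LinearIndependent ℚ γ := linearIndependent_rat_of_ofRatClass hli
  have hγ'Q : LinearIndependent ℚ fun a =>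
      singularCohomology.map ℚ ℚ (h : C(ComplexPoints X, ComplexPoints Y)) 1 (γ a) := by
    rw [Fintype.linearIndependent_iff] at hγQ ⊢
    intro q hq
    refine hγQ q ?_
    have := congrArg (singularCohomology.map ℚ ℚ (h.symm : C(ComplexPoints Y, ComplexPoints X)) 1) hq
    simpa only [map_sum, map_smul, map_zero, singularCohomology.map_symm_map] using this
  -- `ℤ`-independence in the lattice
  have hvZ : LinearIndependent ℤ v := by
    refine LinearIndependent.of_comp (integralLattice X 1).subtype ?_
    exact hγ'Q.restrict_scalars' ℤ
  -- spanning: every integral class of `X` is a `ℤ`-combination (transport to `Y` and back)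
  have hsp : ⊤ ≤ Submodule.span ℤ (Set.range v) := by
    rintro ⟨y, hy⟩ -
    have hyY : IsIntegralClass (ofRatClass _ 1
        (singularCohomology.map ℚ ℚ (h.symm : C(ComplexPoints Y, ComplexPoints X)) 1 y)) := by
      rw [isIntegralClass_Motives.ofRatClass_map_iff_of_homeomorph h.symm]
      exact mem_integralLattice_iff.1 hy
    obtain ⟨c, hc⟩ := (Submodule.mem_span_range_iff_exists_fun ℤ).1 ((hint _).1 hyY)
    have hc' : ∑ a, c a • γ a =
        singularCohomology.map ℚ ℚ (h.symm : C(ComplexPoints Y, ComplexPoints X)) 1 y := by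
      apply ofRatClass_injective (Y := ComplexPoints Y) 1
      rw [map_sum]
      simpa only [map_zsmul] using hc
    have hy' : (⟨y, hy⟩ : integralLattice X 1) = ∑ a, c a • v a := by
      apply Subtype.ext
      have h2 := congrArg (singularCohomology.map ℚ ℚ (h : C(ComplexPoints X, ComplexPoints Y)) 1) hc'.symm
      rw [singularCohomology.map_map_symm, map_sum] at h2
      rw [Submodule.coe_sum]
      refine h2.trans (Finset.sum_congr rfl fun a _ => ?_)
      rw [map_zsmul, Submodule.coe_smul_of_tower]
    rw [hy']
    exact Submodule.sum_mem _ fun a _ => Submodule.smul_mem _ _ (Submodule.subset_span ⟨a, rfl⟩)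
  exact ⟨Module.Basis.mk hvZ hsp, fun a => by rw [Module.Basis.mk_apply]⟩

end Frames

/-- **SOCKET (B1a) `UHead.Ue_P4b1a_flatFrameUniformisations` DISCHARGED — flat-framed, uniformised fibres of the
universal family over a chart ball at the classifying point of an admissible triple.**  Statement = the P4 lead's
v0.6 socket text (B-typ02's binders verbatim + amendment (α): the fibre identification is the PINNED
`e x := homeomorphOfIso (fibreAVIso (P′ x) ≪≫ (fiberUnivIsoOfIsBaseChangeVia 𝓜 x (P′ x) (G x) (Ĝ x) (hbc x)).symm)`),
with the HOME notion `IsFlatIntegralFrame (univFamilyℂ 𝓜) hU γ` written out as its three clauses (independence,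
`ℤ`-span = integral classes, invariance under `transportFun` along every homotopy class of paths in `W`).
PROOF. `W` := the chart ball of ★ `exists_chartBall_locallyTrivialOn` at `x₀` for the algebraic chart (the universal
family is homotopically locally trivial over all of `M(ℂ)`, ★ `isHomotopicallyLocallyTrivialOn_univ_of_isSmoothProjectiveFamily`);
`P′, G, Ĝ, hbc` by ★ `exists_triple_isBaseChangeVia_classifyingPoint_eq`; `P′ x₀` is admissible (★
`isAdmissibleAt_of_classifyingMap_eq`), whence `m₁, Θ₀, Λ₀`; `m₀` := the `γ = 1` re-base of `m₁` (★
`exists_rebase_γ_eq_one`, same `r`-map); the frame at `x₀` is the `ℤ`-basis of `H¹(X_{x₀}; ℤ)/tors` pulled back to the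
lattice classes by `e x₀ ∘ m₀` (★ `exists_basis_integralLattice_map_eq_latticeClass`), spread to the flat frame `γ` by ★
`exists_flatIntegralFrame_eq_of_simplyConnectedSpace`; at `x ≠ x₀` the uniformisation is ★
`exists_uniformisation_of_basis_integralLattice` on the `ℤ`-basis `e x^* γ x` (`exists_basis_integralLattice_of_frame`)
and `Θ x` is ★ `Polarization.exists_ample`; at `x₀` they are `(m₀.Ψ, m₀, Θ₀)` themselves.
[cite: VoisinHodgeI2002, §9.2.1 and Thm. 9.3] [cite: MumfordFogartyKirwan1994, Ch. 7 §3 Theorem 7.9 (p. 139) and Appendix 7A (pp. 234–235)]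
[cite: Lange2023AbelianVarietiesComplex, §1.1.3 Lemma 1.1.17 (a) (p. 14)] [cite: Milne2005ShimuraVarieties, §6 Thm. 6.11 pp. 74–75 and (63) p. 116] -/
theorem ue_P4b1a_flatFrameUniformisations_holds :
  ∀ (g N : ℕ) (δ : Fin g → ℕ) (_hg : 0 < g) (hδ : IsPolarizationType δ) (_hN : 3 ≤ N)
    (𝓜 : SiegelFineModuliScheme g N δ) (_hMq : HodgeTheory.IsQuasiProjectiveOver 𝓜.M) (_hXq : HodgeTheory.IsQuasiProjectiveOver (W1.univTotal 𝓜))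
    (r : gspFinAdelic δ)
    (d : ℕ) [SmoothOfRelativeDimension d ((Motives.baseChange ℚ ℂ).obj 𝓜.M).hom],
    haveI : IsLocallyNoetherian (specOver ℚ ℂ).left :=
      inferInstanceAs (IsLocallyNoetherian (Spec (CommRingCat.of ℂ)))
    haveI : Smooth ((Motives.baseChange ℚ ℂ).obj 𝓜.M).hom := SmoothOfRelativeDimension.smooth d _
    haveI : LocallyOfFiniteType ((Motives.baseChange ℚ ℂ).obj 𝓜.M).hom := inferInstance
    r ∈ principalLevelSubgroup δ 1 →
    ∀ (Z₀ : Matrix (Fin g) (Fin g) ℂ) (hZ₀ : Z₀ ∈ siegelUpperHalfSpace g)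
      (P₀ : PolarizedAbelianSchemeWithLevel g N δ (specOver ℚ ℂ).left), IsAdmissibleAt hδ r Z₀ hZ₀ P₀ →
    ∃ (W : Set (ComplexPoints ((Motives.baseChange ℚ ℂ).obj 𝓜.M))) (x₀ : W),
      (x₀ : ComplexPoints ((Motives.baseChange ℚ ℂ).obj 𝓜.M)) =
          AlgPoints.baseChangeEquiv (algebraMap ℚ ℂ) 𝓜.M (𝓜.classifyingMap (specOver ℚ ℂ) P₀) ∧
      IsOpen W ∧ IsPathConnected W ∧
      W ⊆ (ComplexPoints.algebraicChart ((Motives.baseChange ℚ ℂ).obj 𝓜.M) d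
        (x₀ : ComplexPoints ((Motives.baseChange ℚ ℂ).obj 𝓜.M))).source ∧
      ∃ (hU : HodgeTheory.IsCohomologicallyLocallyTrivialOn (W1.univFamilyℂ 𝓜) W)
        (P' : W → PolarizedAbelianSchemeWithLevel g N δ (specOver ℚ ℂ).left)
        (G : ∀ x : W, (P' x).A.X.left ⟶ 𝓜.univ.A.X.left) (Ĝ : ∀ x : W, (P' x).D.hat.X.left ⟶ 𝓜.univ.D.hat.X.left)
        (hbc : ∀ x : W, (P' x).IsBaseChangeVia 𝓜.univ
          ((AlgPoints.baseChangeEquiv (algebraMap ℚ ℂ) 𝓜.M).symm x.1).left (G x) (Ĝ x))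
        (γ : ∀ x : W, Fin g ⊕ Fin g →
          singularCohomology ℚ ℚ (ComplexPoints (fiberOver (W1.univFamilyℂ 𝓜) x.1)) 1)
        (Φ : ∀ _x : W, (Fin g ⊕ Fin g → ℝ) ≃L[ℝ] (Fin g → ℂ))
        (φ : ∀ x : W, C(ComplexTorus (Φ x), ((P' x).A.fibre (𝟙 (Spec (CommRingCat.of ℂ)))).toAbelianVariety.Points ℂ))
        (Θ : ∀ x : W, CartierDivisor ((P' x).A.fibre (𝟙 (Spec (CommRingCat.of ℂ)))).toAbelianVariety.X.left)
        (m₀ : SiegelAdelicMarking ⟨jOfSiegel δ Z₀, SiegelComplexRecordSystem.jOfSiegel_mem_C0pm hδ.1 hZ₀⟩ r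
          ((P' x₀).A.fibre (𝟙 (Spec (CommRingCat.of ℂ)))).toAbelianVariety)
        (Λ₀ : (P' x₀).level.SymplecticLift (𝟙 (Spec (CommRingCat.of ℂ))) (Θ x₀) δ),
        -- (cls) the fibre triples are classified by their points
        (∀ x : W, AlgPoints.baseChangeEquiv (algebraMap ℚ ℂ) 𝓜.M (𝓜.classifyingMap (specOver ℚ ℂ) (P' x)) = x.1) ∧
        -- (N1) `γ` is a flat integral frame of `R¹` of the universal family over `W` (the three clauses of
        -- `HodgeTheory.IsFlatIntegralFrame (W1.univFamilyℂ 𝓜) hU γ`)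
        ((∀ x : W, LinearIndependent ℂ fun a => ofRatClass _ 1 (γ x a)) ∧
          (∀ (x : W) (c : HodgeTheory.complexBetti (fiberOver (W1.univFamilyℂ 𝓜) x.1) 1),
            HodgeTheory.IsIntegralClass c ↔ c ∈ Submodule.span ℤ (Set.range fun a => ofRatClass _ 1 (γ x a))) ∧
          ∀ (x x' : W) (p : Path.Homotopic.Quotient x x') (a : Fin g ⊕ Fin g),
            HodgeTheory.transportFun (W1.univFamilyℂ 𝓜) 1 hU p (ofRatClass _ 1 (γ x a)) = ofRatClass _ 1 (γ x' a)) ∧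
        -- the uniformisations: analytifications, additive, framed by `γ x` through the pinned `e x`
        (∀ x : W, IsAnalytification (Fin g → ℂ)
          ((P' x).A.fibre (𝟙 (Spec (CommRingCat.of ℂ)))).toAbelianVariety.X
          ((P' x).A.fibre (𝟙 (Spec (CommRingCat.of ℂ)))).toAbelianVariety.dim (φ x)) ∧
        (∀ (x : W) (s t : ComplexTorus (Φ x)), φ x (s + t) = φ x s * φ x t) ∧
        (∀ (x : W) (a : Fin g ⊕ Fin g),
          singularCohomology.map ℚ ℚ
              (((Motives.AlgPoints.homeomorphOfIso (L := ℂ)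
                  (W1.fibreAVIso (P' x) ≪≫
                    (W1.fiberUnivIsoOfIsBaseChangeVia 𝓜 x.1 (P' x) (G x) (Ĝ x) (hbc x)).symm) :
                  ((P' x).A.fibre (𝟙 (Spec (CommRingCat.of ℂ)))).toAbelianVariety.Points ℂ ≃ₜ
                    ComplexPoints (fiberOver (W1.univFamilyℂ 𝓜) x.1)) :
                C(((P' x).A.fibre (𝟙 (Spec (CommRingCat.of ℂ)))).toAbelianVariety.Points ℂ,
                  ComplexPoints (fiberOver (W1.univFamilyℂ 𝓜) x.1))).comp (φ x)) 1 (γ x a) =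
            HodgeTheory.latticeClass (Φ x) a) ∧
        -- ample `IsLambdaOfAt` witnesses of the polarisations
        (∀ x : W, (Θ x).IsAmple) ∧
        (∀ x : W, (P' x).A.IsLambdaOfAt (𝟙 (Spec (CommRingCat.of ℂ))) (P' x).D (P' x).pol.lam (Θ x)) ∧
        -- BASE CASE at `x₀`: the `x₀`-uniformisation IS a marking `m₀` by `[J(Z₀), r]` with `γ = 1` …
        m₀.γ = 1 ∧ m₀.Ψ = Φ x₀ ∧ (∀ t : ComplexTorus (Φ x₀), m₀.toFun t = φ x₀ t) ∧
        -- … and the symplectic lift `Λ₀` of `((P′ x₀).level, Θ x₀)` is matched to `m₀`'s torsion tower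
        (∀ ⦃M : ℕ⦄, N ∣ M → M ≠ 0 → ∀ (c : Fin g ⊕ Fin g → ZMod M) (v : Fin g ⊕ Fin g → ℚ),
          AdelicCongr ((r⁻¹ : gspFinAdelic δ) : GL (Fin g ⊕ Fin g) finAdeleQ) 1 v (fun i => ((c i).val : ℚ) / M) →
            ((Λ₀.lift M (Multiplicative.ofAdd c)) :
                ((P' x₀).A.fibre (𝟙 (Spec (CommRingCat.of ℂ)))).toAbelianVariety.Points ℂ) = m₀.r v) := by
  intro g N δ hg hδ hN 𝓜 hMq hXq r d _ hr1 Z₀ hZ₀ P₀ hP₀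
  classical
  haveI : IsLocallyNoetherian (specOver ℚ ℂ).left :=
    inferInstanceAs (IsLocallyNoetherian (Spec (CommRingCat.of ℂ)))
  haveI : Smooth ((Motives.baseChange ℚ ℂ).obj 𝓜.M).hom := SmoothOfRelativeDimension.smooth d _
  haveI : LocallyOfFiniteType ((Motives.baseChange ℚ ℂ).obj 𝓜.M).hom := inferInstance
  -- §A the chart ball `W` at the classifying point `x₀'` of `P₀`
  have hHuniv : HodgeTheory.IsHomotopicallyLocallyTrivialOn (W1.univFamilyℂ 𝓜)
      (Set.univ : Set (ComplexPoints ((Motives.baseChange ℚ ℂ).obj 𝓜.M))) :=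
    HodgeTheory.isHomotopicallyLocallyTrivialOn_univ_of_isSmoothProjectiveFamily (W1.univFamilyℂ 𝓜) d
      (UnivFamilyHodgeFrames.isSmoothProjectiveFamily_univFamilyℂ_of_classify 𝓜)
      (UnivFamilyHodgeFrames.isQuasiProjectiveOver_baseChange_M 𝓜 hMq)
  set x₀' : ComplexPoints ((Motives.baseChange ℚ ℂ).obj 𝓜.M) :=
    AlgPoints.baseChangeEquiv (algebraMap ℚ ℂ) 𝓜.M (𝓜.classifyingMap (specOver ℚ ℂ) P₀) with hx₀'
  obtain ⟨ε, -, -, hWo, hx₀W, -, -, -, -, hWsc, hWpc, hWh, hWc⟩ :=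
    HodgeTheory.exists_chartBall_locallyTrivialOn (W1.univFamilyℂ 𝓜) hHuniv isOpen_univ (Set.mem_univ x₀')
      (ComplexPoints.algebraicChart ((Motives.baseChange ℚ ℂ).obj 𝓜.M) d x₀')
      (ComplexPoints.mem_algebraicChart_source _ d x₀') Filter.univ_mem
  set W : Set (ComplexPoints ((Motives.baseChange ℚ ℂ).obj 𝓜.M)) :=
    (ComplexPoints.algebraicChart ((Motives.baseChange ℚ ℂ).obj 𝓜.M) d x₀').source ∩
      (ComplexPoints.algebraicChart ((Motives.baseChange ℚ ℂ).obj 𝓜.M) d x₀') ⁻¹'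
        Metric.ball (ComplexPoints.algebraicChart ((Motives.baseChange ℚ ℂ).obj 𝓜.M) d x₀' x₀') ε with hW
  haveI : SimplyConnectedSpace W := hWsc
  obtain ⟨x₀, hx₀⟩ : ∃ x₀ : W, (x₀ : ComplexPoints ((Motives.baseChange ℚ ℂ).obj 𝓜.M)) = x₀' :=
    ⟨⟨x₀', hx₀W⟩, rfl⟩
  -- §B fibre triples with base-change witnesses, classified by their points (★ P4a)
  choose P' G Ĝ hbc hcls using fun x : W => 𝓜.exists_triple_isBaseChangeVia_classifyingPoint_eq x.1
  let e : ∀ x : W, ((P' x).A.fibre (𝟙 (Spec (CommRingCat.of ℂ)))).toAbelianVariety.Points ℂ ≃ₜ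
      ComplexPoints (fiberOver (W1.univFamilyℂ 𝓜) x.1) := fun x =>
    Motives.AlgPoints.homeomorphOfIso (L := ℂ)
      (W1.fibreAVIso (P' x) ≪≫ (W1.fiberUnivIsoOfIsBaseChangeVia 𝓜 x.1 (P' x) (G x) (Ĝ x) (hbc x)).symm)
  -- §C base case: `P′ x₀` is admissible; re-base its marking to `γ = 1`
  have hadm : IsAdmissibleAt hδ r Z₀ hZ₀ (P' x₀) :=
    𝓜.isAdmissibleAt_of_classifyingMap_eq hδ P₀ (P' x₀) hP₀
      ((AlgPoints.baseChangeEquiv (algebraMap ℚ ℂ) 𝓜.M).injective ((hcls x₀).trans hx₀))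
  obtain ⟨m₁, Θ₀, Λ₀, hΘ₀, hlam₀, htower⟩ := hadm
  obtain ⟨m₀, hγ₀1, -, hr₀⟩ := m₁.exists_rebase_γ_eq_one hr1
  let φ₀ : C(ComplexTorus m₀.Ψ, ((P' x₀).A.fibre (𝟙 (Spec (CommRingCat.of ℂ)))).toAbelianVariety.Points ℂ) :=
    ⟨m₀.toFun, m₀.isAnalytification.isHomeomorph.continuous⟩
  have hψ₀ : IsHomeomorph (((e x₀ : _ ≃ₜ _) : C(_, ComplexPoints (fiberOver (W1.univFamilyℂ 𝓜) x₀.1))).comp φ₀) :=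
    (e x₀).isHomeomorph.comp m₀.isAnalytification.isHomeomorph
  obtain ⟨ℓ₀, hℓ₀⟩ := HodgeTheory.exists_basis_integralLattice_map_eq_latticeClass m₀.Ψ
    (((e x₀ : _ ≃ₜ _) : C(_, ComplexPoints (fiberOver (W1.univFamilyℂ 𝓜) x₀.1))).comp φ₀) hψ₀
  obtain ⟨hli₀, hint₀⟩ := frame_of_basis_integralLattice m₀.Ψ _ ℓ₀ hℓ₀
  obtain ⟨γ, hγx₀, hli, hint, htr⟩ :=
    HodgeTheory.exists_flatIntegralFrame_eq_of_simplyConnectedSpace (W1.univFamilyℂ 𝓜) 1 hWc hWh x₀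
      (fun a => ((ℓ₀ a : HodgeTheory.integralLattice (fiberOver (W1.univFamilyℂ 𝓜) x₀.1) 1) :
        singularCohomology ℚ ℚ (ComplexPoints (fiberOver (W1.univFamilyℂ 𝓜) x₀.1)) 1)) hli₀ hint₀
  -- §E ample witnesses (`Θ₀` at `x₀`)
  have hΘex : ∀ x : W, ∃ Θ : CartierDivisor ((P' x).A.fibre (𝟙 (Spec (CommRingCat.of ℂ)))).toAbelianVariety.X.left,
      Θ.IsAmple ∧ (P' x).A.IsLambdaOfAt (𝟙 (Spec (CommRingCat.of ℂ))) (P' x).D (P' x).pol.lam Θ ∧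
        (x = x₀ → HEq Θ Θ₀) := by
    intro x
    by_cases hx : x = x₀
    · subst hx
      exact ⟨Θ₀, hΘ₀, hlam₀, fun _ => HEq.rfl⟩
    · obtain ⟨Θ, h1, h2⟩ := (P' x).pol.exists_ample ℂ (𝟙 (Spec (CommRingCat.of ℂ)))
      exact ⟨Θ, h1, h2, fun h => absurd h hx⟩
  choose Θ hΘamp hΘlam hΘx₀ using hΘex
  have hΘ₀eq : Θ x₀ = Θ₀ := eq_of_heq (hΘx₀ x₀ rfl)
  obtain ⟨Λ₀', hΛ₀'⟩ : ∃ Λ' : (P' x₀).level.SymplecticLift (𝟙 (Spec (CommRingCat.of ℂ))) (Θ x₀) δ,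
      ∀ (M : ℕ) (c : Fin g ⊕ Fin g → ZMod M),
        ((Λ'.lift M (Multiplicative.ofAdd c)) :
            ((P' x₀).A.fibre (𝟙 (Spec (CommRingCat.of ℂ)))).toAbelianVariety.Points ℂ) =
          ((Λ₀.lift M (Multiplicative.ofAdd c)) :
            ((P' x₀).A.fibre (𝟙 (Spec (CommRingCat.of ℂ)))).toAbelianVariety.Points ℂ) := by
    rw [hΘ₀eq]
    exact ⟨Λ₀, fun _ _ => rfl⟩
  -- §F uniformisations framed by `γ x` through `e x` (`m₀` itself at `x₀`)
  have hUex : ∀ x : W, ∃ (Φ : (Fin g ⊕ Fin g → ℝ) ≃L[ℝ] (Fin g → ℂ))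
      (φ : C(ComplexTorus Φ, ((P' x).A.fibre (𝟙 (Spec (CommRingCat.of ℂ)))).toAbelianVariety.Points ℂ)),
      IsAnalytification (Fin g → ℂ)
          ((P' x).A.fibre (𝟙 (Spec (CommRingCat.of ℂ)))).toAbelianVariety.X
          ((P' x).A.fibre (𝟙 (Spec (CommRingCat.of ℂ)))).toAbelianVariety.dim φ ∧
        (∀ s t : ComplexTorus Φ, φ (s + t) = φ s * φ t) ∧
        (∀ a : Fin g ⊕ Fin g, singularCohomology.map ℚ ℚ
            (((e x : _ ≃ₜ _) : C(_, ComplexPoints (fiberOver (W1.univFamilyℂ 𝓜) x.1))).comp φ) 1 (γ x a) =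
          HodgeTheory.latticeClass Φ a) ∧
        (x = x₀ → Φ = m₀.Ψ ∧ HEq (⇑φ) m₀.toFun) := by
    intro x
    by_cases hx : x = x₀
    · subst hx
      refine ⟨m₀.Ψ, φ₀, m₀.isAnalytification, m₀.toFun_add, fun a => ?_, fun _ => ⟨rfl, HEq.rfl⟩⟩
      rw [hγx₀]
      exact hℓ₀ a
    · obtain ⟨b, hb⟩ := exists_basis_integralLattice_of_frame (e x) (γ x) (hli x) (hint x)
      obtain ⟨Φ, φ, han, hadd, hfr⟩ :=
        HodgeTheory.AbelianVariety.exists_uniformisation_of_basis_integralLattice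
          ((P' x).A.fibre (𝟙 (Spec (CommRingCat.of ℂ)))).toAbelianVariety (W1.fibreAV_dim (P' x)) b
      refine ⟨Φ, φ, han, hadd, fun a => ?_, fun h => absurd h hx⟩
      rw [← singularCohomology.map_map, ← hb a]
      exact hfr a
  choose Φ φ han hadd hframe hUx₀ using hUex
  obtain ⟨hΦ₀, hφ₀⟩ := hUx₀ x₀ rfl
  have hφ₀' : ∀ t : ComplexTorus (Φ x₀), m₀.toFun t = φ x₀ t := fun t =>
    (congrFun (eq_of_heq hφ₀) t).symm
  refine ⟨W, x₀, hx₀, hWo, hWpc, ?_, hWc, P', G, Ĝ, hbc, γ, Φ, φ, Θ, m₀, Λ₀', hcls, ⟨hli, hint, htr⟩, han, hadd,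
    hframe, hΘamp, hΘlam, hγ₀1, hΦ₀.symm, hφ₀', ?_⟩
  · rw [hx₀]
    exact Set.inter_subset_left
  · intro M hNM hM c v hv
    rw [hΛ₀', hr₀]
    exact htower hNM hM c v hv

end UnivFamilyFlatFramedFibres

end Summit.HodgeConjecture.HodgeConjecture.Theorems

end
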